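import Literature.Probability.Percolation.TrapPairCross
import HarnessLib

/-!
# The cross-frame pair step: two clean routes exiting on different sides (contraction + Menger)

Topic `Literature/Probability/Percolation`; family `crit-perc` / near-critical percolation on `𝕋`.
A brick of the near-critical arm-separation theorem for four arms in the ADJACENT colour
arrangement (P. Nolin, EJP 13 (2008), Thm. 11, `j = 4`, `σ = BBWW` [arXiv 0711.4948: Thm. 10];
the input `hsepAdj` of `Werner2009_lemma63_of_altSeparation_of_adjSeparation`).

`CrossData.exists_two_disjoint_routes` (`TrapPairCross.lean`) joins the two starts of two arms of
the same colour landing on different sides to two distinct fence sites by vertex-disjoint admissible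
paths; but such paths may pass through the connections of other fences, and the two fences reached
may lie close to each other on one side. Here the fences are contracted PER STRUCTURE: every fence
site of the structure `D₁` (fences of the terms from below and from above, in actual coordinates)
is identified with one representative site `r₁`, every fence site of `D₂` with `r₂`
(`CrossData.cG`, on the non-fence admissible sites `B𝔅`). Menger's theorem for two paths in the
contracted graph (`exists_two_disjoint_paths`, Diestel Thm. 3.3.1) needs no admissible vertex to be
a cut: for a non-fence site this is the hypothesis of the `𝕋`-setting (`menger_hcut𝔄`) truncated
at the first fence site; for `r₁` (all fences of `D₁` removed) it is a route of `D₂` avoiding every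
fence site of `D₁` — the hypothesis `hav₂`, discharged from the planar position of the fences in
`TrapPairAvoid.lean` — and symmetrically for `r₂`. The two disjoint contracted paths end at `r₁` and
at `r₂`; lifted to `𝕋` and continued inside one fence connection each, they are two vertex-disjoint
CLEAN routes (`exists_two_clean_routes`): sites off all fences (arms and terms, inside `Λ_{2M}`)
and the connection of one fence, the two fences belonging to different structures, hence to
different sides.

* `PairDataB.FFB` — all fence sites of a structure; `CrossData.FF𝔉₁/₂`, `B𝔅`, `ExitRef` (a fence of
  one of the four families, its actual connection `F𝔄` and fence site `m𝔄`);
* `CrossData.cG`, `hcut_cG`, **`CrossData.exists_two_clean_routes`**.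

Everything here is proved; no named facts are introduced.

## References

* P. Nolin, Near-critical percolation in two dimensions, *Electron. J. Probab.* 13 (2008), §4.4,
  proof of Lemma 15 (arXiv 0711.4948: Lemma 14) [Nolin2008].
* R. Diestel, *Graph Theory*, 5th ed. (2017), Thm. 3.3.1 (Menger) and §1.7 (contraction) [Diestel2017].
-/

noncomputable section

open Set

namespace Literature.Probability.Percolation

open LatticeModels Literature.Combinatorics.SimpleGraph
open PairData (term_isCrossing term_eq)

/-! ### All fence sites of one structure -/

namespace PairDataB

variable {M n k₀ K T T' : ℕ} {ω : SiteConfig (Site 2)}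

/-- **All fence sites of the structure**: the connections of the fences of the terms from below
and from above. [folklore] -/
def FFB (D : PairDataB M n k₀ K T T' ω) : Set (Site 2) :=
  {v | ∃ (u : ℕ) (c : Finset (Site 2)) (z : Site 2) (hu : (trapDomain M).lowestSeq ω u = some (c, z)), v ∈ (D.fence hu).F} ∪
    {v | ∃ (u : ℕ) (d : Finset (Site 2)) (z : Site 2) (hu : (trapDomain M).flip.lowestSeq ω u = some (d, z)), v ∈ (D.fenceUp hu).F}

/-- Fence sites are admissible. [folklore] -/
theorem FFB_subset_AsetB (D : PairDataB M n k₀ K T T' ω) : D.FFB ⊆ D.AsetB := by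
  rintro v (⟨u, c, z, hu, hv⟩ | ⟨u, d, z, hu, hv⟩)
  · exact D.Aset_subset_AsetB (D.fence_subset_Aset hu hv)
  · exact D.fenceUp_subset_AsetB hu hv

/-- The targets are fence sites. [folklore] -/
theorem TsetB_subset_FFB (D : PairDataB M n k₀ K T T' ω) : D.TsetB ⊆ D.FFB := by
  rintro v (⟨u, c, z, hu, rfl⟩ | ⟨u, d, z, hu, rfl⟩)
  · exact Or.inl ⟨u, c, z, hu, (D.fence hu).m_mem⟩
  · exact Or.inr ⟨u, d, z, hu, (D.fenceUp hu).m_mem⟩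

/-- Fence sites avoid the arms. [folklore] -/
theorem not_mem_FFB_of_mem_armSet (D : PairDataB M n k₀ K T T' ω) {v : Site 2} (hv : v ∈ D.armSet) : v ∉ D.FFB := by
  rintro (⟨u, c, z, hu, hvF⟩ | ⟨u, d, z, hu, hvF⟩)
  · exact D.fence_disjoint_arm hu hvF hv
  · exact D.fenceUp_disjoint_arm hu hvF hv

end PairDataB

namespace CrossData

variable {M n k₀ K T₁ T₁' T₂ T₂' : ℕ} {χ₁ χ₂ : SiteConfig (Site 2)} (X : CrossData M n k₀ K T₁ T₁' T₂ T₂' χ₁ χ₂)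

/-! ### Actual fence sites, non-fence sites, exits -/

/-- The actual fence sites of `D₁`. [folklore] -/
def FF𝔉₁ : Set (Site 2) := X.φ₁ '' X.D₁.FFB

/-- The actual fence sites of `D₂`. [folklore] -/
def FF𝔉₂ : Set (Site 2) := X.φ₂ '' X.D₂.FFB

/-- All actual fence sites. [folklore] -/
def FF𝔉 : Set (Site 2) := X.FF𝔉₁ ∪ X.FF𝔉₂

/-- **The non-fence admissible sites** (arms and terms of both structures). [folklore] -/
def B𝔅 : Set (Site 2) := X.Aset𝔄 \ X.FF𝔉

/-- The two families of actual fence sites are disjoint. [folklore] -/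
theorem FF_disjoint {v : Site 2} (h₁ : v ∈ X.FF𝔉₁) (h₂ : v ∈ X.FF𝔉₂) : False := by
  obtain ⟨x, hx, rfl⟩ := h₁
  obtain ⟨y, hy, hxy⟩ := h₂
  exact X.fence_far x y hx hy hxy.symm

/-- Fence sites are admissible. [folklore] -/
theorem FF_subset_Aset𝔄 : X.FF𝔉 ⊆ X.Aset𝔄 := by
  rintro v (⟨x, hx, rfl⟩ | ⟨x, hx, rfl⟩)
  · exact Or.inl ⟨x, X.D₁.FFB_subset_AsetB hx, rfl⟩
  · exact Or.inr ⟨x, X.D₂.FFB_subset_AsetB hx, rfl⟩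

/-- The targets are fence sites. [folklore] -/
theorem Tset𝔗_subset_FF : X.Tset𝔗 ⊆ X.FF𝔉 := by
  rintro v (⟨x, hx, rfl⟩ | ⟨x, hx, rfl⟩)
  · exact Or.inl ⟨x, X.D₁.TsetB_subset_FFB hx, rfl⟩
  · exact Or.inr ⟨x, X.D₂.TsetB_subset_FFB hx, rfl⟩

/-- The starts are not fence sites. [folklore] -/
theorem start_not_mem_FF {s : Site 2} (hs : s ∈ X.Src) : s ∉ X.FF𝔉 := by
  have key : ∀ i : Fin 2, X.φ₁ (X.D₁.a i) ∉ X.FF𝔉 := by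
    intro i
    rintro (⟨x, hx, hxe⟩ | ⟨x, hx, hxe⟩)
    · rw [X.φ₁.injective hxe] at hx
      exact X.D₁.not_mem_FFB_of_mem_armSet (X.D₁.mem_armSet (X.D₁.A i).start_mem_support) hx
    · have harm : X.D₁.a i ∈ X.D₁.armSet := X.D₁.mem_armSet (X.D₁.A i).start_mem_support
      have h2 := (X.armSet_corr).1 harm
      rw [← hxe, RelIso.symm_apply_apply] at h2
      exact X.D₂.not_mem_FFB_of_mem_armSet h2 hx
  rcases hs with h | h
  · rw [h]; exact key 0
  · rw [Set.mem_singleton_iff.1 h]; exact key 1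

/-- The starts are non-fence admissible sites. [folklore] -/
theorem start_mem_B𝔅 {s : Site 2} (hs : s ∈ X.Src) : s ∈ X.B𝔅 := by
  refine ⟨?_, X.start_not_mem_FF hs⟩
  rcases hs with h | h
  · rw [h]; exact Or.inl ⟨_, X.D₁.Aset_subset_AsetB (X.D₁.armSet_subset_Aset (X.D₁.mem_armSet (X.D₁.A 0).start_mem_support)), rfl⟩
  · rw [Set.mem_singleton_iff.1 h]
    exact Or.inl ⟨_, X.D₁.Aset_subset_AsetB (X.D₁.armSet_subset_Aset (X.D₁.mem_armSet (X.D₁.A 1).start_mem_support)), rfl⟩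

/-- **An exit of the cross step**: a fence of one of the four families (structure `D₁`/`D₂`, term
from below/from above). [folklore] -/
inductive ExitRef (X : CrossData M n k₀ K T₁ T₁' T₂ T₂' χ₁ χ₂) : Type
  | below₁ (u : ℕ) (c : Finset (Site 2)) (z : Site 2) (hu : (trapDomain M).lowestSeq χ₁ u = some (c, z)) : ExitRef X
  | up₁ (u : ℕ) (d : Finset (Site 2)) (z : Site 2) (hu : (trapDomain M).flip.lowestSeq χ₁ u = some (d, z)) : ExitRef X
  | below₂ (u : ℕ) (c : Finset (Site 2)) (z : Site 2) (hu : (trapDomain M).lowestSeq χ₂ u = some (c, z)) : ExitRef X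
  | up₂ (u : ℕ) (d : Finset (Site 2)) (z : Site 2) (hu : (trapDomain M).flip.lowestSeq χ₂ u = some (d, z)) : ExitRef X

variable {X} in
/-- The structure (side) of an exit. [folklore] -/
def ExitRef.side : X.ExitRef → Fin 2
  | .below₁ _ _ _ _ => 0
  | .up₁ _ _ _ _ => 0
  | .below₂ _ _ _ _ => 1
  | .up₂ _ _ _ _ => 1

variable {X} in
/-- The actual connection of the fence of an exit. [folklore] -/
def ExitRef.F𝔄 : X.ExitRef → Set (Site 2)
  | .below₁ _ _ _ hu => X.φ₁ '' (X.D₁.fence hu).F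
  | .up₁ _ _ _ hu => X.φ₁ '' (X.D₁.fenceUp hu).F
  | .below₂ _ _ _ hu => X.φ₂ '' (X.D₂.fence hu).F
  | .up₂ _ _ _ hu => X.φ₂ '' (X.D₂.fenceUp hu).F

variable {X} in
/-- The actual fence site of an exit. [folklore] -/
def ExitRef.m𝔄 : X.ExitRef → Site 2
  | .below₁ _ _ _ hu => X.φ₁ (X.D₁.fence hu).m
  | .up₁ _ _ _ hu => X.φ₁ (X.D₁.fenceUp hu).m
  | .below₂ _ _ _ hu => X.φ₂ (X.D₂.fence hu).m
  | .up₂ _ _ _ hu => X.φ₂ (X.D₂.fenceUp hu).m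

variable {X} in
/-- The connection of an exit of the side `0` consists of fence sites of `D₁`, of the side `1` of `D₂`. [folklore] -/
theorem ExitRef.F𝔄_subset (e : X.ExitRef) : (e.side = 0 → e.F𝔄 ⊆ X.FF𝔉₁) ∧ (e.side = 1 → e.F𝔄 ⊆ X.FF𝔉₂) := by
  cases e with
  | below₁ u c z hu => exact ⟨fun _ => Set.image_mono fun v hv => Or.inl ⟨u, c, z, hu, hv⟩, fun h => absurd h (by simp [ExitRef.side])⟩
  | up₁ u d z hu => exact ⟨fun _ => Set.image_mono fun v hv => Or.inr ⟨u, d, z, hu, hv⟩, fun h => absurd h (by simp [ExitRef.side])⟩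
  | below₂ u c z hu => exact ⟨fun h => absurd h (by simp [ExitRef.side]), fun _ => Set.image_mono fun v hv => Or.inl ⟨u, c, z, hu, hv⟩⟩
  | up₂ u d z hu => exact ⟨fun h => absurd h (by simp [ExitRef.side]), fun _ => Set.image_mono fun v hv => Or.inr ⟨u, d, z, hu, hv⟩⟩

variable {X} in
/-- The connection of an exit consists of fence sites. [folklore] -/
theorem ExitRef.F𝔄_subset_FF (e : X.ExitRef) : e.F𝔄 ⊆ X.FF𝔉 := by
  obtain ⟨h0, h1⟩ := e.F𝔄_subset
  have : e.side = 0 ∨ e.side = 1 := by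
    rcases e with _ | _ | _ | _ <;> simp [ExitRef.side]
  rcases this with h | h
  · exact (h0 h).trans Set.subset_union_left
  · exact (h1 h).trans Set.subset_union_right

variable {X} in
/-- Connections of exits on different sides are disjoint. [folklore] -/
theorem ExitRef.F𝔄_disjoint {e e' : X.ExitRef} (h : e.side ≠ e'.side) : Disjoint e.F𝔄 e'.F𝔄 := by
  rw [Set.disjoint_left]
  intro v hv hv'
  obtain ⟨h0, h1⟩ := e.F𝔄_subset
  obtain ⟨h0', h1'⟩ := e'.F𝔄_subset
  have hs : ∀ f : X.ExitRef, f.side = 0 ∨ f.side = 1 := fun f => by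
    rcases f with _ | _ | _ | _ <;> simp [ExitRef.side]
  rcases hs e with he | he <;> rcases hs e' with he' | he'
  · exact h (he.trans he'.symm)
  · exact X.FF_disjoint (h0 he hv) (h1' he' hv')
  · exact X.FF_disjoint (h0' he' hv') (h1 he hv)
  · exact h (he.trans he'.symm)

/-! ### The contracted graph -/

/-- **Adjacency to a contracted structure**: `y` is the representative `r₁` (`r₂`) and `x` is
`𝕋`-adjacent to an actual fence site of `D₁` (`D₂`). [folklore] -/
def AdjF (r₁ r₂ x y : Site 2) : Prop :=
  (y = r₁ ∧ ∃ f ∈ X.FF𝔉₁, triGraph.Adj x f) ∨ (y = r₂ ∧ ∃ f ∈ X.FF𝔉₂, triGraph.Adj x f)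

/-- **The contracted graph**: `𝕋`-adjacency between non-fence sites, and a non-fence site joined to
the representative of each structure one of whose fence sites it is adjacent to. [cite: Diestel2017, §1.7] -/
def cG (r₁ r₂ : Site 2) : SimpleGraph (Site 2) where
  Adj x y := x ≠ y ∧ ((x ∉ X.FF𝔉 ∧ y ∉ X.FF𝔉 ∧ triGraph.Adj x y) ∨ (x ∉ X.FF𝔉 ∧ X.AdjF r₁ r₂ x y) ∨ (y ∉ X.FF𝔉 ∧ X.AdjF r₁ r₂ y x))
  symm := ⟨fun _ _ ⟨hne, h⟩ => ⟨hne.symm, by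
    rcases h with h | h | h
    · exact Or.inl ⟨h.2.1, h.1, h.2.2.symm⟩
    · exact Or.inr (Or.inr h)
    · exact Or.inr (Or.inl h)⟩⟩
  loopless := ⟨fun _ h => h.1 rfl⟩

/-- The admissible vertices of the contracted graph: non-fence sites and the two representatives. [folklore] -/
def cA (r₁ r₂ : Site 2) : Set (Site 2) := X.B𝔅 ∪ {r₁, r₂}

variable {X}

/-- A `𝕋`-path through non-fence sites is a path of the contracted graph. [folklore] -/
theorem pathIn_cG_of_pathIn {r₁ r₂ : Site 2} {Y : Set (Site 2)} {x y : Site 2}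
    (h : PathIn triGraph Y x y) (hY : ∀ v ∈ Y, v ∉ X.FF𝔉) : PathIn (X.cG r₁ r₂) Y x y := by
  obtain ⟨hx, h⟩ := h
  refine ⟨hx, ?_⟩
  induction h with
  | refl => exact Relation.ReflTransGen.refl
  | @tail b c hb hbc ih =>
    have hbY : b ∈ Y := (show PathIn triGraph Y x b from ⟨hx, hb⟩).right_mem
    exact ih.tail ⟨⟨hbc.1.ne, Or.inl ⟨hY b hbY, hY c hbc.2, hbc.1⟩⟩, hbc.2⟩

/-- A path of the contracted graph through non-fence sites is a `𝕋`-path (representatives in `FF`). [folklore] -/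
theorem pathIn_of_pathIn_cG {r₁ r₂ : Site 2} (hr₁ : r₁ ∈ X.FF𝔉) (hr₂ : r₂ ∈ X.FF𝔉) {Y : Set (Site 2)} {x y : Site 2}
    (h : PathIn (X.cG r₁ r₂) Y x y) (hY : ∀ v ∈ Y, v ∉ X.FF𝔉) : PathIn triGraph Y x y := by
  obtain ⟨hx, h⟩ := h
  refine ⟨hx, ?_⟩
  have hAF : ∀ {a b : Site 2}, X.AdjF r₁ r₂ a b → b ∈ X.FF𝔉 := by
    rintro a b (⟨rfl, -⟩ | ⟨rfl, -⟩)
    exacts [hr₁, hr₂]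
  induction h with
  | refl => exact Relation.ReflTransGen.refl
  | @tail b c hb hbc ih =>
    have hbY : b ∈ Y := (show PathIn (X.cG r₁ r₂) Y x b from ⟨hx, hb⟩).right_mem
    have hadj : triGraph.Adj b c := by
      rcases hbc.1.2 with h | h | h
      · exact h.2.2
      · exact absurd (hAF h.2) (hY c hbc.2)
      · exact absurd (hAF h.2) (hY b hbY)
    exact ih.tail ⟨hadj, hbc.2⟩

/-- **From an admissible `𝕋`-route reaching a fence site to a contracted route** avoiding `z`:
truncate at the first fence site and enter the representative of its structure. The representative
entered must differ from `z`: either `rₛ ≠ z`, or the route avoids the fence sites of that structure. [cite: Diestel2017, §1.7] -/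
theorem cRoute_of_route {r₁ r₂ : Site 2} (hr₁ : r₁ ∈ X.FF𝔉₁) (hr₂ : r₂ ∈ X.FF𝔉₂) {z s t : Site 2} {Y : Set (Site 2)}
    (hz₁ : r₁ ≠ z ∨ ∀ v ∈ Y, v ∉ X.FF𝔉₁) (hz₂ : r₂ ≠ z ∨ ∀ v ∈ Y, v ∉ X.FF𝔉₂)
    (hs : s ∉ X.FF𝔉) (ht : t ∈ X.FF𝔉) (hYA : Y ⊆ X.Aset𝔄 \ {z}) (h : PathIn triGraph Y s t) :
    ∃ t', (t' = r₁ ∨ t' = r₂) ∧ PathIn (X.cG r₁ r₂) (X.cA r₁ r₂ \ {z}) s t' := by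
  have hsR : s ∈ (X.FF𝔉)ᶜ := hs
  have htR : t ∉ (X.FF𝔉)ᶜ := fun h' => h' ht
  obtain ⟨a', b, ha', hbR, hbY, hab, hP⟩ := h.exit (R := (X.FF𝔉)ᶜ) hsR htR
  have hbF : b ∈ X.FF𝔉 := not_not.1 hbR
  have hsub : (X.FF𝔉)ᶜ ∩ Y ⊆ X.cA r₁ r₂ \ {z} := fun v hv => ⟨Or.inl ⟨(hYA hv.2).1, hv.1⟩, (hYA hv.2).2⟩
  have hP' : PathIn (X.cG r₁ r₂) (X.cA r₁ r₂ \ {z}) s a' := (pathIn_cG_of_pathIn hP fun v hv => hv.1).mono hsub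
  have ha'F : a' ∉ X.FF𝔉 := ha'
  have hr₁F : r₁ ∈ X.FF𝔉 := Or.inl hr₁
  have hr₂F : r₂ ∈ X.FF𝔉 := Or.inr hr₂
  rcases hbF with hb | hb
  · have hne : r₁ ≠ z := hz₁.resolve_right fun hno => hno b hbY hb
    have hm : r₁ ∈ X.cA r₁ r₂ \ {z} := ⟨Or.inr (Or.inl rfl), fun e => hne (Set.mem_singleton_iff.1 e)⟩
    have hadj : (X.cG r₁ r₂).Adj a' r₁ :=
      ⟨fun e => ha'F (by rw [e]; exact hr₁F), Or.inr (Or.inl ⟨ha'F, Or.inl ⟨rfl, b, hb, hab⟩⟩)⟩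
    exact ⟨r₁, Or.inl rfl, hP'.tail hadj hm⟩
  · have hne : r₂ ≠ z := hz₂.resolve_right fun hno => hno b hbY hb
    have hm : r₂ ∈ X.cA r₁ r₂ \ {z} := ⟨Or.inr (Or.inr rfl), fun e => hne (Set.mem_singleton_iff.1 e)⟩
    have hadj : (X.cG r₁ r₂).Adj a' r₂ :=
      ⟨fun e => ha'F (by rw [e]; exact hr₂F), Or.inr (Or.inl ⟨ha'F, Or.inr ⟨rfl, b, hb, hab⟩⟩)⟩
    exact ⟨r₂, Or.inr rfl, hP'.tail hadj hm⟩

/-! ### No admissible vertex of the contracted graph is a cut -/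

/-- **No admissible vertex of the contracted graph is a cut**, under the two AVOIDANCE HYPOTHESES:
some start of `D₁` (`D₂`) is joined, inside the enlarged admissible set of `D₁` (`D₂`) and off every
actual fence site of `D₂` (`D₁`), to a fence site of `D₁` (`D₂`) — discharged from
`PairDataB.route_c_avoid/route_d_avoid` (`TrapPairAvoid.lean`) and the position of the fences. [cite: Nolin2008, §4.4 Lemma 15 (proof) (arXiv 0711.4948: Lemma 14, last paragraph)] [cite: Diestel2017, §1.7] -/
theorem hcut_cG {r₁ r₂ : Site 2} (hr₁ : r₁ ∈ X.FF𝔉₁) (hr₂ : r₂ ∈ X.FF𝔉₂)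
    (hav₁ : (∃ (i : Fin 2) (S : Set (Site 2)) (t : Site 2), t ∈ X.D₁.FFB ∧ PathIn triGraph S (X.D₁.a i) t ∧ S ⊆ X.D₁.AsetB ∧
      ∀ x ∈ S, X.φ₁ x ∉ X.FF𝔉₂))
    (hav₂ : (∃ (i : Fin 2) (S : Set (Site 2)) (t : Site 2), t ∈ X.D₂.FFB ∧ PathIn triGraph S (X.D₂.a i) t ∧ S ⊆ X.D₂.AsetB ∧
      ∀ x ∈ S, X.φ₂ x ∉ X.FF𝔉₁)) :
    ∀ zz ∈ X.cA r₁ r₂, ∃ (s t : Site 2) (q : (X.cG r₁ r₂).Walk s t), s ∈ X.Src ∧ t ∈ ({r₁, r₂} : Set (Site 2)) ∧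
      (∀ y ∈ q.support, y ∈ X.cA r₁ r₂) ∧ zz ∉ q.support := by
  classical
  have hr₁F : r₁ ∈ X.FF𝔉 := Or.inl hr₁
  have hr₂F : r₂ ∈ X.FF𝔉 := Or.inr hr₂
  have hne : r₁ ≠ r₂ := fun e => X.FF_disjoint hr₁ (e ▸ hr₂)
  -- packaging a contracted route
  have pack : ∀ {s t zz : Site 2}, s ∈ X.Src → (t = r₁ ∨ t = r₂) → PathIn (X.cG r₁ r₂) (X.cA r₁ r₂ \ {zz}) s t →
      ∃ (s' t' : Site 2) (q : (X.cG r₁ r₂).Walk s' t'), s' ∈ X.Src ∧ t' ∈ ({r₁, r₂} : Set (Site 2)) ∧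
        (∀ y ∈ q.support, y ∈ X.cA r₁ r₂) ∧ zz ∉ q.support := by
    intro s t zz hs ht hP
    obtain ⟨w, hw⟩ := hP.exists_walk
    refine ⟨s, t, w, hs, ?_, fun y hy => (hw y hy).1, fun hy => (hw zz hy).2 (Set.mem_singleton zz)⟩
    rcases ht with rfl | rfl
    exacts [Or.inl rfl, Or.inr rfl]
  rintro zz (hzz | hzz)
  · -- a non-fence site: Menger's hypothesis of the `𝕋`-setting, truncated at the first fence site
    obtain ⟨s, t, q, hs, ht, hqA, hzq⟩ := X.menger_hcut𝔄 zz hzz.1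
    have hP : PathIn triGraph {v | v ∈ q.support} s t := PathIn.of_walk q fun x hx => hx
    have hYA : {v | v ∈ q.support} ⊆ X.Aset𝔄 \ {zz} := fun v hv =>
      ⟨hqA v hv, fun e => hzq (by rw [← Set.mem_singleton_iff.1 e]; exact hv)⟩
    obtain ⟨t', ht', hP'⟩ := cRoute_of_route (z := zz) hr₁ hr₂ (Or.inl fun e => hzz.2 (e ▸ hr₁F))
      (Or.inl fun e => hzz.2 (e ▸ hr₂F)) (X.start_not_mem_FF hs) (X.Tset𝔗_subset_FF ht) hYA hP
    exact pack hs ht' hP'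
  · -- a representative: the avoiding route of the other structure
    rcases hzz with hz | hz
    · obtain ⟨i, S, t, ht, hP, hSA, hSav⟩ := hav₂
      have hYA : X.φ₂ '' S ⊆ X.Aset𝔄 \ {zz} := by
        rintro v ⟨x, hx, rfl⟩
        exact ⟨Or.inr ⟨x, hSA hx, rfl⟩, fun e => hSav x hx (by rw [Set.mem_singleton_iff.1 e, hz]; exact hr₁)⟩
      have hs := X.start_mem₂ i
      obtain ⟨t', ht', hQ⟩ := cRoute_of_route (z := zz) hr₁ hr₂ (Or.inr (by rintro v ⟨x, hx, rfl⟩; exact hSav x hx))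
        (Or.inl fun e => hne (e.trans hz).symm) (X.start_not_mem_FF hs) (Or.inr ⟨t, ht, rfl⟩) hYA (pathIn_map_iso X.φ₂ hP)
      exact pack hs ht' hQ
    · rw [Set.mem_singleton_iff] at hz
      obtain ⟨i, S, t, ht, hP, hSA, hSav⟩ := hav₁
      have hYA : X.φ₁ '' S ⊆ X.Aset𝔄 \ {zz} := by
        rintro v ⟨x, hx, rfl⟩
        exact ⟨Or.inl ⟨x, hSA hx, rfl⟩, fun e => hSav x hx (by rw [Set.mem_singleton_iff.1 e, hz]; exact hr₂)⟩
      have hs := X.start_mem₁ i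
      obtain ⟨t', ht', hQ⟩ := cRoute_of_route (z := zz) hr₁ hr₂ (Or.inl fun e => hne (hz ▸ e))
        (Or.inr (by rintro v ⟨x, hx, rfl⟩; exact hSav x hx)) (X.start_not_mem_FF hs) (Or.inl ⟨t, ht, rfl⟩) hYA
        (pathIn_map_iso X.φ₁ hP)
      exact pack hs ht' hQ

/-! ### Two clean routes -/

/-- **Finishing a contracted route** whose only representative is its end `t`: the last edge before
`t` is an adjacency to an actual fence site of the structure of `t`; continue inside the connection
of that fence to its fence site. [cite: Diestel2017, §1.7] -/
theorem finish {r₁ r₂ : Site 2} (hr₁ : r₁ ∈ X.FF𝔉₁) (hr₂ : r₂ ∈ X.FF𝔉₂) {s t : Site 2} (p : (X.cG r₁ r₂).Walk s t)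
    (hs : s ∈ X.B𝔅) (ht : t ∈ ({r₁, r₂} : Set (Site 2))) (hpA : ∀ y ∈ p.support, y ∈ X.cA r₁ r₂)
    (honly : ∀ y ∈ p.support, y ∈ ({r₁, r₂} : Set (Site 2)) → y = t) :
    ∃ (e : X.ExitRef) (S : Set (Site 2)), (e.side = 0 ↔ t = r₁) ∧ PathIn triGraph S s e.m𝔄 ∧ e.m𝔄 ∈ e.F𝔄 ∧
      S ⊆ {v | v ∈ p.support ∧ v ∈ X.B𝔅} ∪ e.F𝔄 := by
  classical
  have hr₁F : r₁ ∈ X.FF𝔉 := Or.inl hr₁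
  have hr₂F : r₂ ∈ X.FF𝔉 := Or.inr hr₂
  have hne : r₁ ≠ r₂ := fun e => X.FF_disjoint hr₁ (e ▸ hr₂)
  have hRF : ∀ y ∈ ({r₁, r₂} : Set (Site 2)), y ∈ X.FF𝔉 := by
    rintro y (h | h)
    · exact h ▸ hr₁F
    · exact (Set.mem_singleton_iff.1 h) ▸ hr₂F
  have hP : PathIn (X.cG r₁ r₂) {v | v ∈ p.support} s t := PathIn.of_walk p fun x hx => hx
  have hsR : s ∈ ({r₁, r₂} : Set (Site 2))ᶜ := fun h => hs.2 (hRF s h)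
  have htR : t ∉ ({r₁, r₂} : Set (Site 2))ᶜ := fun h => h ht
  obtain ⟨a', b, -, hbR, hbp, hab, hQ⟩ := hP.exit (R := ({r₁, r₂} : Set (Site 2))ᶜ) hsR htR
  have hbR' : b ∈ ({r₁, r₂} : Set (Site 2)) := not_not.1 hbR
  have hbt : b = t := honly b hbp hbR'
  have hpre : ({r₁, r₂} : Set (Site 2))ᶜ ∩ {v | v ∈ p.support} ⊆ {v | v ∈ p.support ∧ v ∈ X.B𝔅} := fun v hv =>
    ⟨hv.2, by rcases hpA v hv.2 with h | h; exacts [h, absurd h hv.1]⟩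
  have hQ' : PathIn triGraph {v | v ∈ p.support ∧ v ∈ X.B𝔅} s a' :=
    pathIn_of_pathIn_cG hr₁F hr₂F (hQ.mono hpre) fun v hv => hv.2.2
  have ha'F : a' ∉ X.FF𝔉 := (hpre hQ.right_mem).2.2
  have hbF : b ∈ X.FF𝔉 := hRF b hbR'
  -- the edge `a' → b` is an adjacency of `a'` to an actual fence site of the structure of `b`
  have hAF : X.AdjF r₁ r₂ a' b := by
    rcases hab.2 with h | h | h
    · exact absurd hbF h.2.1
    · exact h.2
    · exact absurd hbF h.1
  rcases hAF with ⟨hb1, f, hf, haf⟩ | ⟨hb2, f, hf, haf⟩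
  · have htr : t = r₁ := hbt.symm.trans hb1
    obtain ⟨f₀, hf₀, rfl⟩ := hf
    rcases hf₀ with ⟨u, c, z, hu, hfF⟩ | ⟨u, d, z, hu, hfF⟩
    · let S' : Set (Site 2) := {v | v ∈ p.support ∧ v ∈ X.B𝔅} ∪ X.φ₁ '' (X.D₁.fence hu).F
      refine ⟨ExitRef.below₁ u c z hu, S', iff_of_true rfl htr, ?_, Set.mem_image_of_mem _ (X.D₁.fence hu).m_mem, subset_rfl⟩
      have h1 : PathIn triGraph S' s (X.φ₁ f₀) :=
        (hQ'.mono (Set.subset_union_left : _ ⊆ S')).tail haf (Or.inr (Set.mem_image_of_mem _ hfF))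
      exact h1.trans ((pathIn_map_iso X.φ₁ ((X.D₁.fence hu).pathIn_to_m hfF)).mono (Set.subset_union_right : _ ⊆ S'))
    · let S' : Set (Site 2) := {v | v ∈ p.support ∧ v ∈ X.B𝔅} ∪ X.φ₁ '' (X.D₁.fenceUp hu).F
      refine ⟨ExitRef.up₁ u d z hu, S', iff_of_true rfl htr, ?_, Set.mem_image_of_mem _ (X.D₁.fenceUp hu).m_mem, subset_rfl⟩
      have h1 : PathIn triGraph S' s (X.φ₁ f₀) :=
        (hQ'.mono (Set.subset_union_left : _ ⊆ S')).tail haf (Or.inr (Set.mem_image_of_mem _ hfF))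
      exact h1.trans ((pathIn_map_iso X.φ₁ ((X.D₁.fenceUp hu).pathIn_to_m hfF)).mono (Set.subset_union_right : _ ⊆ S'))
  · have htr : t = r₂ := hbt.symm.trans hb2
    have hiff : ∀ q : Fin 2, q = 1 → (q = 0 ↔ t = r₁) := by
      rintro q rfl
      exact iff_of_false (by decide) fun e => hne (e.symm.trans htr)
    obtain ⟨f₀, hf₀, rfl⟩ := hf
    rcases hf₀ with ⟨u, c, z, hu, hfF⟩ | ⟨u, d, z, hu, hfF⟩
    · let S' : Set (Site 2) := {v | v ∈ p.support ∧ v ∈ X.B𝔅} ∪ X.φ₂ '' (X.D₂.fence hu).F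
      refine ⟨ExitRef.below₂ u c z hu, S', hiff _ rfl, ?_, Set.mem_image_of_mem _ (X.D₂.fence hu).m_mem, subset_rfl⟩
      have h1 : PathIn triGraph S' s (X.φ₂ f₀) :=
        (hQ'.mono (Set.subset_union_left : _ ⊆ S')).tail haf (Or.inr (Set.mem_image_of_mem _ hfF))
      exact h1.trans ((pathIn_map_iso X.φ₂ ((X.D₂.fence hu).pathIn_to_m hfF)).mono (Set.subset_union_right : _ ⊆ S'))
    · let S' : Set (Site 2) := {v | v ∈ p.support ∧ v ∈ X.B𝔅} ∪ X.φ₂ '' (X.D₂.fenceUp hu).F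
      refine ⟨ExitRef.up₂ u d z hu, S', hiff _ rfl, ?_, Set.mem_image_of_mem _ (X.D₂.fenceUp hu).m_mem, subset_rfl⟩
      have h1 : PathIn triGraph S' s (X.φ₂ f₀) :=
        (hQ'.mono (Set.subset_union_left : _ ⊆ S')).tail haf (Or.inr (Set.mem_image_of_mem _ hfF))
      exact h1.trans ((pathIn_map_iso X.φ₂ ((X.D₂.fenceUp hu).pathIn_to_m hfF)).mono (Set.subset_union_right : _ ⊆ S'))

/-- **Two vertex-disjoint clean routes exiting on different sides.** Under the avoidance
hypotheses, the two starts are joined to the fence sites of two fences of DIFFERENT structures by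
vertex-disjoint `𝕋`-paths, each through non-fence admissible sites (arms and terms of both
structures) and the connection of its own fence only. [cite: Nolin2008, §4.4 Lemma 15 (proof) (arXiv 0711.4948: Lemma 14, last paragraph)] [cite: Diestel2017, Thm. 3.3.1 and §1.7] -/
theorem exists_two_clean_routes
    (hav₁ : (∃ (i : Fin 2) (S : Set (Site 2)) (t : Site 2), t ∈ X.D₁.FFB ∧ PathIn triGraph S (X.D₁.a i) t ∧ S ⊆ X.D₁.AsetB ∧
      ∀ x ∈ S, X.φ₁ x ∉ X.FF𝔉₂))
    (hav₂ : (∃ (i : Fin 2) (S : Set (Site 2)) (t : Site 2), t ∈ X.D₂.FFB ∧ PathIn triGraph S (X.D₂.a i) t ∧ S ⊆ X.D₂.AsetB ∧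
      ∀ x ∈ S, X.φ₂ x ∉ X.FF𝔉₁)) :
    ∃ (e₀ e₁ : X.ExitRef) (S₀ S₁ : Set (Site 2)), e₀.side ≠ e₁.side ∧
      PathIn triGraph S₀ (X.φ₁ (X.D₁.a 0)) e₀.m𝔄 ∧ PathIn triGraph S₁ (X.φ₁ (X.D₁.a 1)) e₁.m𝔄 ∧
      e₀.m𝔄 ∈ e₀.F𝔄 ∧ e₁.m𝔄 ∈ e₁.F𝔄 ∧ S₀ ⊆ X.B𝔅 ∪ e₀.F𝔄 ∧ S₁ ⊆ X.B𝔅 ∪ e₁.F𝔄 ∧ Disjoint S₀ S₁ := by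
  classical
  -- representatives: the fence sites of the minimal terms from below
  obtain ⟨c₁, z₁, hu₁, -⟩ := X.D₁.uMin_spec
  obtain ⟨c₂, z₂, hu₂, -⟩ := X.D₂.uMin_spec
  have hr₁ : X.φ₁ (X.D₁.fence hu₁).m ∈ X.FF𝔉₁ := ⟨_, Or.inl ⟨_, c₁, z₁, hu₁, (X.D₁.fence hu₁).m_mem⟩, rfl⟩
  have hr₂ : X.φ₂ (X.D₂.fence hu₂).m ∈ X.FF𝔉₂ := ⟨_, Or.inl ⟨_, c₂, z₂, hu₂, (X.D₂.fence hu₂).m_mem⟩, rfl⟩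
  generalize hgr₁ : X.φ₁ (X.D₁.fence hu₁).m = r₁ at hr₁
  generalize hgr₂ : X.φ₂ (X.D₂.fence hu₂).m = r₂ at hr₂
  have hne : r₁ ≠ r₂ := fun e => X.FF_disjoint hr₁ (e ▸ hr₂)
  have hcut := hcut_cG hr₁ hr₂ hav₁ hav₂
  have hone : ∃ (s t : Site 2) (q : (X.cG r₁ r₂).Walk s t), s ∈ X.Src ∧ t ∈ ({r₁, r₂} : Set (Site 2)) ∧
      ∀ y ∈ q.support, y ∈ X.cA r₁ r₂ := by
    obtain ⟨s, t, q, hs, ht, hA, -⟩ := hcut (X.φ₁ (X.D₁.a 0)) (Or.inl (X.start_mem_B𝔅 (X.start_mem₁ 0)))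
    exact ⟨s, t, q, hs, ht, hA⟩
  obtain ⟨s₁, t₁, s₂, t₂, p₁, p₂, hs₁, ht₁, hs₂, ht₂, -, -, hA₁, hA₂, hdisj⟩ :=
    exists_two_disjoint_paths (G := X.cG r₁ r₂) hone hcut
  have hs : s₁ ≠ s₂ := fun h => hdisj s₁ p₁.start_mem_support (by rw [h]; exact p₂.start_mem_support)
  have ht : t₁ ≠ t₂ := fun h => hdisj _ p₁.end_mem_support (by rw [h]; exact p₂.end_mem_support)
  have two : ∀ y ∈ ({r₁, r₂} : Set (Site 2)), y = t₁ ∨ y = t₂ := by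
    intro y hy
    simp only [Set.mem_insert_iff, Set.mem_singleton_iff] at hy ht₁ ht₂
    rcases ht₁ with rfl | rfl <;> rcases ht₂ with rfl | rfl
    · exact absurd rfl ht
    · exact hy
    · exact hy.symm
    · exact absurd rfl ht
  have honly₁ : ∀ y ∈ p₁.support, y ∈ ({r₁, r₂} : Set (Site 2)) → y = t₁ := fun y hy hyR =>
    (two y hyR).elim id fun h => absurd (h ▸ p₂.end_mem_support) (hdisj y hy)
  have honly₂ : ∀ y ∈ p₂.support, y ∈ ({r₁, r₂} : Set (Site 2)) → y = t₂ := fun y hy hyR =>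
    (two y hyR).elim (fun h => absurd hy (hdisj y (h ▸ p₁.end_mem_support))) id
  obtain ⟨e₁, S₁, hside₁, hP₁, hm₁, hS₁⟩ := finish hr₁ hr₂ p₁ (X.start_mem_B𝔅 hs₁) ht₁ hA₁ honly₁
  obtain ⟨e₂, S₂, hside₂, hP₂, hm₂, hS₂⟩ := finish hr₁ hr₂ p₂ (X.start_mem_B𝔅 hs₂) ht₂ hA₂ honly₂
  have hs01 : ∀ f : X.ExitRef, f.side = 0 ∨ f.side = 1 := fun f => by
    rcases f with _ | _ | _ | _ <;> simp [ExitRef.side]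
  have hside : e₁.side ≠ e₂.side := by
    intro h
    simp only [Set.mem_insert_iff, Set.mem_singleton_iff] at ht₁ ht₂
    rcases hs01 e₁ with h0 | h0
    · exact ht ((hside₁.1 h0).trans (hside₂.1 (h ▸ h0)).symm)
    · have h1 : e₁.side ≠ 0 := by rw [h0]; decide
      have h2 : e₂.side ≠ 0 := by rw [← h, h0]; decide
      have ht₁' : t₁ = r₂ := ht₁.resolve_left fun e => h1 (hside₁.2 e)
      have ht₂' : t₂ = r₂ := ht₂.resolve_left fun e => h2 (hside₂.2 e)
      exact ht (ht₁'.trans ht₂'.symm)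
  have hdisjS : Disjoint S₁ S₂ := by
    rw [Set.disjoint_left]
    intro y hy₁ hy₂
    rcases hS₁ hy₁ with h₁ | h₁ <;> rcases hS₂ hy₂ with h₂ | h₂
    · exact hdisj y h₁.1 h₂.1
    · exact h₁.2.2 (e₂.F𝔄_subset_FF h₂)
    · exact h₂.2.2 (e₁.F𝔄_subset_FF h₁)
    · exact Set.disjoint_left.1 (ExitRef.F𝔄_disjoint hside) h₁ h₂
  have hS₁' : S₁ ⊆ X.B𝔅 ∪ e₁.F𝔄 := hS₁.trans (Set.union_subset_union_left _ fun v hv => hv.2)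
  have hS₂' : S₂ ⊆ X.B𝔅 ∪ e₂.F𝔄 := hS₂.trans (Set.union_subset_union_left _ fun v hv => hv.2)
  simp only [Src, Set.mem_insert_iff, Set.mem_singleton_iff] at hs₁ hs₂
  rcases hs₁ with rfl | rfl <;> rcases hs₂ with rfl | rfl
  · exact absurd rfl hs
  · exact ⟨e₁, e₂, S₁, S₂, hside, hP₁, hP₂, hm₁, hm₂, hS₁', hS₂', hdisjS⟩
  · exact ⟨e₂, e₁, S₂, S₁, hside.symm, hP₂, hP₁, hm₂, hm₁, hS₂', hS₁', hdisjS.symm⟩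
  · exact absurd rfl hs

/-- **Non-fence sites of a clean route lie in `Λ_{2M}`** (they are arm or term sites of one of the
structures, carried by a graph automorphism preserving... ) — recorded in the form used downstream:
a non-fence admissible site is the image of an arm or term site of `D₁` or of `D₂`. [folklore] -/
theorem mem_B𝔅 {v : Site 2} (hv : v ∈ X.B𝔅) :
    (∃ x, (x ∈ X.D₁.armSet ∨ (∃ (u : ℕ) (c : Finset (Site 2)) (z : Site 2) (_ : (trapDomain M).lowestSeq χ₁ u = some (c, z)), x ∈ c) ∨
        ∃ (u : ℕ) (d : Finset (Site 2)) (z : Site 2) (_ : (trapDomain M).flip.lowestSeq χ₁ u = some (d, z)), x ∈ d) ∧ X.φ₁ x = v) ∨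
      ∃ x, (x ∈ X.D₂.armSet ∨ (∃ (u : ℕ) (c : Finset (Site 2)) (z : Site 2) (_ : (trapDomain M).lowestSeq χ₂ u = some (c, z)), x ∈ c) ∨
        ∃ (u : ℕ) (d : Finset (Site 2)) (z : Site 2) (_ : (trapDomain M).flip.lowestSeq χ₂ u = some (d, z)), x ∈ d) ∧ X.φ₂ x = v := by
  obtain ⟨hvA, hvF⟩ := hv
  rcases hvA with ⟨x, hx, rfl⟩ | ⟨x, hx, rfl⟩
  · left
    refine ⟨x, ?_, rfl⟩
    rcases hx with (hx | ⟨u, c, z, hu, hx | hx⟩) | ⟨u, d, z, hu, hx | hx⟩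
    · exact Or.inl hx
    · exact Or.inr (Or.inl ⟨u, c, z, hu, hx⟩)
    · exact absurd (Or.inl ⟨x, Or.inl ⟨u, c, z, hu, hx⟩, rfl⟩ : X.φ₁ x ∈ X.FF𝔉) hvF
    · exact Or.inr (Or.inr ⟨u, d, z, hu, hx⟩)
    · exact absurd (Or.inl ⟨x, Or.inr ⟨u, d, z, hu, hx⟩, rfl⟩ : X.φ₁ x ∈ X.FF𝔉) hvF
  · right
    refine ⟨x, ?_, rfl⟩
    rcases hx with (hx | ⟨u, c, z, hu, hx | hx⟩) | ⟨u, d, z, hu, hx | hx⟩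
    · exact Or.inl hx
    · exact Or.inr (Or.inl ⟨u, c, z, hu, hx⟩)
    · exact absurd (Or.inr ⟨x, Or.inl ⟨u, c, z, hu, hx⟩, rfl⟩ : X.φ₂ x ∈ X.FF𝔉) hvF
    · exact Or.inr (Or.inr ⟨u, d, z, hu, hx⟩)
    · exact absurd (Or.inr ⟨x, Or.inr ⟨u, d, z, hu, hx⟩, rfl⟩ : X.φ₂ x ∈ X.FF𝔉) hvF

end CrossData

end Literature.Probability.Percolation
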